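import Literature.NumberTheory.EllipticCurves.BurungaleSkinner2023.EisensteinTwistsBSDFormula
import Literature.NumberTheory.EllipticCurves.HeegnerPointsImaginaryQuadraticProofs
import Literature.NumberTheory.QuadraticFields.FundamentalDiscriminant
import Mathlib.NumberTheory.NumberField.InfinitePlace.TotallyRealComplex
import Mathlib.Data.Nat.PrimeFin
import HarnessLib

/-!
# Burungale–Skinner 2023 — the families of quadratic characters: dictionary with fundamental
# discriminants, infinitude, and "positive proportion ⇒ infinitely many" (PROVED)

A. Burungale, C. Skinner, Proc. AMS Ser. B 10 (2023), Thm. 2.9 (p. 21): "positive density among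
the set of all odd quadratic characters (when ordered by conductor)"; Thms. 3.2, 3.5 (pp. 25, 27).
The typing (`RankOneTwistsPAdicRegulator.lean`) indexes odd, resp. even, quadratic characters by
the discriminants of imaginary, resp. real, quadratic fields (`IsOddQuadraticCharDiscr`,
`IsEvenQuadraticCharDiscr`) and states "positive proportion" as positive LOWER density
(`OddQuadraticCharPosProportion`, `EvenQuadraticCharPosProportion`). This file PROVES:

* the dictionary with the tree's fundamental discriminants
  (`QuadraticFields/FundamentalDiscriminant.lean`: `isFundamentalDiscriminant_discr`,
  `exists_numberField_discr_eq`; `isImaginaryQuadratic_iff_discr_neg`):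
  `IsOddQuadraticCharDiscr d ↔ (d fundamental) ∧ d < 0` and
  `IsEvenQuadraticCharDiscr d ↔ (d fundamental) ∧ 0 < d` (Cox, *Primes of the form x² + ny²*,
  §5.B: quadratic fields ↔ fundamental discriminants, imaginary ↔ `d_K < 0`);
* both families are infinite (witnesses `∓8q`, `q` an odd prime);
* a positive lower density inside an infinite family is an infinite set
  (`OddQuadraticCharPosProportion.infinite`, `EvenQuadraticCharPosProportion.infinite`), hence the
  "infinitely many twists" forms of Thms. 2.9, 3.2, 3.5 by name
  (`thm29_infinitelyMany_twists_rankOne_nondegenerate`, `thm32_infinitelyMany_twists_pPartBSD`,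
  `thm35_infinitelyMany_evenTwists_pPartBSD_rankZero`) — the shape in which Thm. 2.11 is printed.

Theorems only; no new facts.

References: [BurungaleSkinner2023] Thm. 2.9 (p. 21), Thms. 3.2, 3.5 (pp. 25, 27); [Cox2013] §5.B.
-/

noncomputable section

open scoped Classical

open Filter NumberField NumberField.InfinitePlace WeierstrassCurve
  Literature.NumberTheory.EllipticCurves Literature.NumberTheory.EllipticCurves.Rank1Residual
  Literature.NumberTheory.QuadraticFields.Quadratic

namespace Literature.NumberTheory.EllipticCurves.BurungaleSkinner2023

/-! ### The dictionary with fundamental discriminants -/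

/-- A quadratic field with `0 < d_K` is totally real (`sign d_K = (-1)^{r₂}`, `r₁ + 2 r₂ = 2`).
[folklore] -/
private theorem isTotallyReal_of_finrank_eq_two_of_discr_pos {K : Type} [Field K] [NumberField K]
    (h2 : Module.finrank ℚ K = 2) (hd : 0 < NumberField.discr K) : IsTotallyReal K := by
  rw [← nrComplexPlaces_eq_zero_iff]
  have hsign := NumberField.sign_discr K
  rw [Int.sign_eq_one_of_pos hd] at hsign
  have heven : Even (nrComplexPlaces K) := by
    by_contra h
    rw [Nat.not_even_iff_odd] at h
    rw [h.neg_one_pow] at hsign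
    norm_num at hsign
  have hrk := card_add_two_mul_card_eq_rank K
  rw [h2] at hrk
  obtain ⟨m, hm⟩ := heven
  omega

/-- **`IsOddQuadraticCharDiscr d` iff `d` is a negative fundamental discriminant** (imaginary
quadratic fields ↔ fundamental discriminants `D < 0`; the conductor of the odd quadratic character
`ψ_{ℚ(√d)}` is `|d|`). [cite: Cox2013, §5.B] -/
theorem isOddQuadraticCharDiscr_iff {d : ℤ} :
    IsOddQuadraticCharDiscr d ↔
      ((d % 4 = 1 ∧ Squarefree d ∧ d ≠ 1) ∨
        (4 ∣ d ∧ (d / 4 % 4 = 2 ∨ d / 4 % 4 = 3) ∧ Squarefree (d / 4))) ∧ d < 0 := by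
  constructor
  · rintro ⟨K, _, _, hK, hd⟩
    subst hd
    exact ⟨isFundamentalDiscriminant_discr hK.1, hK.discr_neg⟩
  · rintro ⟨hD, hneg⟩
    obtain ⟨K, _, _, h2, hd⟩ := exists_numberField_discr_eq hD
    refine ⟨K, inferInstance, inferInstance, isImaginaryQuadratic_iff_discr_neg.mpr ⟨h2, ?_⟩, hd⟩
    rw [hd]
    exact hneg

/-- **`IsEvenQuadraticCharDiscr d` iff `d` is a positive fundamental discriminant** (real quadratic
fields ↔ fundamental discriminants `D > 0`). [cite: Cox2013, §5.B] -/
theorem isEvenQuadraticCharDiscr_iff {d : ℤ} :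
    IsEvenQuadraticCharDiscr d ↔
      ((d % 4 = 1 ∧ Squarefree d ∧ d ≠ 1) ∨
        (4 ∣ d ∧ (d / 4 % 4 = 2 ∨ d / 4 % 4 = 3) ∧ Squarefree (d / 4))) ∧ 0 < d := by
  constructor
  · rintro ⟨K, _, _, h2, hreal, hd⟩
    subst hd
    refine ⟨isFundamentalDiscriminant_discr h2, ?_⟩
    have hsign := NumberField.sign_discr K
    rw [nrComplexPlaces_eq_zero_iff.mpr hreal, pow_zero] at hsign
    exact Int.sign_eq_one_iff_pos.mp hsign
  · rintro ⟨hD, hpos⟩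
    obtain ⟨K, _, _, h2, hd⟩ := exists_numberField_discr_eq hD
    refine ⟨K, inferInstance, inferInstance, h2, ?_, hd⟩
    exact isTotallyReal_of_finrank_eq_two_of_discr_pos h2 (by rw [hd]; exact hpos)

/-! ### Both families are infinite -/

/-- `2q` is squarefree for an odd prime `q`. [folklore] -/
private theorem squarefree_two_mul {q : ℕ} (hq : q.Prime) (hq2 : q ≠ 2) :
    Squarefree (2 * q) := by
  rw [Nat.squarefree_mul_iff]
  exact ⟨(Nat.coprime_primes Nat.prime_two hq).mpr (Ne.symm hq2), Nat.squarefree_two,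
    hq.prime.squarefree⟩

/-- `-8q = d_{ℚ(√-2q)}` is the discriminant of an imaginary quadratic field for every odd prime `q`
(`-8q = 4 · (-2q)`, `-2q ≡ 2 (mod 4)` squarefree). [cite: Cox2013, §5.B] -/
theorem isOddQuadraticCharDiscr_neg_eight_mul {q : ℕ} (hq : q.Prime) (hq2 : q ≠ 2) :
    IsOddQuadraticCharDiscr (-(8 * q : ℤ)) := by
  rw [isOddQuadraticCharDiscr_iff]
  have hodd : Odd q := hq.odd_of_ne_two hq2
  obtain ⟨k, hk⟩ := hodd
  have hdiv : (-(8 * q : ℤ)) / 4 = -(2 * q) := by omega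
  refine ⟨Or.inr ⟨⟨-(2 * q), by ring⟩, ?_, ?_⟩, ?_⟩
  · rw [hdiv]
    omega
  · rw [hdiv, ← Int.squarefree_natAbs]
    have hn : (-(2 * (q : ℤ))).natAbs = 2 * q := by omega
    rw [hn]
    exact squarefree_two_mul hq hq2
  · have := hq.pos
    omega

/-- `8q = d_{ℚ(√2q)}` is the discriminant of a real quadratic field for every odd prime `q`
(`8q = 4 · 2q`, `2q ≡ 2 (mod 4)` squarefree). [cite: Cox2013, §5.B] -/
theorem isEvenQuadraticCharDiscr_eight_mul {q : ℕ} (hq : q.Prime) (hq2 : q ≠ 2) :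
    IsEvenQuadraticCharDiscr (8 * q : ℤ) := by
  rw [isEvenQuadraticCharDiscr_iff]
  have hodd : Odd q := hq.odd_of_ne_two hq2
  obtain ⟨k, hk⟩ := hodd
  have hdiv : (8 * q : ℤ) / 4 = 2 * q := by omega
  refine ⟨Or.inr ⟨⟨2 * q, by ring⟩, ?_, ?_⟩, ?_⟩
  · rw [hdiv]
    omega
  · rw [hdiv, ← Int.squarefree_natAbs]
    have hn : (2 * (q : ℤ)).natAbs = 2 * q := by omega
    rw [hn]
    exact squarefree_two_mul hq hq2
  · have := hq.pos
    omega

/-- The odd primes form an infinite set. [folklore] -/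
private theorem infinite_setOf_prime_ne_two : {q : ℕ | q.Prime ∧ q ≠ 2}.Infinite :=
  (Nat.infinite_setOf_prime.sdiff (Set.finite_singleton 2)).mono fun _ hq =>
    ⟨hq.1, fun h => hq.2 (Set.mem_singleton_iff.mpr h)⟩

/-- **There are infinitely many odd quadratic characters** (discriminants of imaginary quadratic
fields), e.g. `-8q`, `q` an odd prime. [cite: Cox2013, §5.B] -/
theorem setOf_isOddQuadraticCharDiscr_infinite : {d : ℤ | IsOddQuadraticCharDiscr d}.Infinite := by
  refine Set.infinite_of_injOn_mapsTo (f := fun q : ℕ => -(8 * (q : ℤ))) ?_ ?_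
    infinite_setOf_prime_ne_two
  · intro a _ b _ h
    simp only [neg_inj] at h
    exact_mod_cast (mul_right_injective₀ (by norm_num : (8 : ℤ) ≠ 0)) h
  · intro q hq
    exact isOddQuadraticCharDiscr_neg_eight_mul hq.1 hq.2

/-- **There are infinitely many even quadratic characters** (discriminants of real quadratic
fields), e.g. `8q`, `q` an odd prime. [cite: Cox2013, §5.B] -/
theorem setOf_isEvenQuadraticCharDiscr_infinite : {d : ℤ | IsEvenQuadraticCharDiscr d}.Infinite := by
  refine Set.infinite_of_injOn_mapsTo (f := fun q : ℕ => (8 * (q : ℤ))) ?_ ?_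
    infinite_setOf_prime_ne_two
  · intro a _ b _ h
    exact_mod_cast (mul_right_injective₀ (by norm_num : (8 : ℤ) ≠ 0)) h
  · intro q hq
    exact isEvenQuadraticCharDiscr_eight_mul hq.1 hq.2

/-! ### Positive lower density inside an infinite family ⇒ infinitely many -/

/-- Counting lemma: if the family `{d | R d}` is infinite and the `d` with `P d` have positive lower
density in it (ordered by `|d|`), then infinitely many `d` of the family satisfy `P`. Indeed the
ball counts `#{R, |d| ≤ X}` are unbounded, so `c · #{R, |d| ≤ X} ≤ #{R, |d| ≤ X, P} ≤ #{R, P}`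
cannot hold for all large `X` with `#{R, P}` finite. [folklore] -/
private theorem infinite_of_posLowerDensity {R P : ℤ → Prop} (hR : {d : ℤ | R d}.Infinite)
    (h : ∃ c : ℝ, 0 < c ∧ ∀ᶠ X : ℕ in atTop,
      c * (Nat.card {d : ℤ | R d ∧ d.natAbs ≤ X} : ℝ) ≤
        Nat.card {d : ℤ | R d ∧ d.natAbs ≤ X ∧ P d}) :
    {d : ℤ | R d ∧ P d}.Infinite := by
  obtain ⟨c, hc, hev⟩ := h
  intro hfin
  set M := {d : ℤ | R d ∧ P d}.ncard with hM
  obtain ⟨n, hn⟩ := exists_nat_gt ((M : ℝ) / c)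
  obtain ⟨T, hTsub, hTcard⟩ := hR.exists_subset_card_eq n
  obtain ⟨X, hX, hXge⟩ := (hev.and (eventually_ge_atTop (T.sup fun d : ℤ => d.natAbs))).exists
  -- lower bound for the ball count
  have hfinX : {d : ℤ | R d ∧ d.natAbs ≤ X}.Finite := by
    refine (Set.finite_Icc (-(X : ℤ)) X).subset ?_
    intro d hd
    simp only [Set.mem_setOf_eq] at hd
    simp only [Set.mem_Icc]
    omega
  have h1 : n ≤ Nat.card {d : ℤ | R d ∧ d.natAbs ≤ X} := by
    have hsub : (T : Set ℤ) ⊆ {d : ℤ | R d ∧ d.natAbs ≤ X} := fun d hd =>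
      ⟨hTsub hd, (Finset.le_sup (f := fun d : ℤ => d.natAbs) (Finset.mem_coe.mp hd)).trans hXge⟩
    have := Set.ncard_le_ncard hsub hfinX
    rw [Set.ncard_coe_finset, hTcard] at this
    rwa [Nat.card_coe_set_eq]
  -- upper bound for the good count
  have h2 : Nat.card {d : ℤ | R d ∧ d.natAbs ≤ X ∧ P d} ≤ M := by
    rw [Nat.card_coe_set_eq, hM]
    exact Set.ncard_le_ncard (fun d hd => ⟨hd.1, hd.2.2⟩) hfin
  have h1' : (n : ℝ) ≤ Nat.card {d : ℤ | R d ∧ d.natAbs ≤ X} := by exact_mod_cast h1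
  have h2' : (Nat.card {d : ℤ | R d ∧ d.natAbs ≤ X ∧ P d} : ℝ) ≤ M := by exact_mod_cast h2
  have h3 : (M : ℝ) < c * n := by
    rw [div_lt_iff₀ hc] at hn
    linarith [mul_comm (n : ℝ) c]
  have h4 : c * (n : ℝ) ≤ c * Nat.card {d : ℤ | R d ∧ d.natAbs ≤ X} :=
    mul_le_mul_of_nonneg_left h1' hc.le
  linarith

/-- **Positive proportion of odd quadratic characters ⇒ infinitely many.**
[cite: BurungaleSkinner2023, Thm. 2.9 (p. 21)] -/
theorem OddQuadraticCharPosProportion.infinite {P : ℤ → Prop}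
    (h : OddQuadraticCharPosProportion P) : {d : ℤ | IsOddQuadraticCharDiscr d ∧ P d}.Infinite :=
  infinite_of_posLowerDensity setOf_isOddQuadraticCharDiscr_infinite h

/-- **Positive proportion of even quadratic characters ⇒ infinitely many.**
[cite: BurungaleSkinner2023, Thm. 3.5 (p. 27)] -/
theorem EvenQuadraticCharPosProportion.infinite {P : ℤ → Prop}
    (h : EvenQuadraticCharPosProportion P) : {d : ℤ | IsEvenQuadraticCharDiscr d ∧ P d}.Infinite :=
  infinite_of_posLowerDensity setOf_isEvenQuadraticCharDiscr_infinite h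

/-! ### The "infinitely many twists" forms of Thms. 2.9, 3.2, 3.5 -/

/-- **Thm. 2.9 ⇒ infinitely many twists** (the shape in which Thm. 2.11 is printed): under the
hypotheses of Thm. 2.9 there are infinitely many discriminants `d` of imaginary quadratic fields with
`rank E^{(d)}(ℚ) = ord_{s=1} L(E^{(d)}, s) = 1`, `λ = 1`, and non-degenerate `3`-adic height on
every minimal model of `E^{(d)}` (`TwistConclusion W 3 d`). [cite: BurungaleSkinner2023, Thm. 2.9 (p. 21)] -/
theorem thm29_infinitelyMany_twists_rankOne_nondegenerate
    (h : thm29_posProportion_twists_rankOne_nondegenerate)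
    (W : WeierstrassCurve ℚ) [W.IsElliptic] [W.IsGloballyMinimal]
    (Φ : AddSubgroup (geomTorsion W (3 : ℤ))) (ℓ₀ : ℕ) [Fact ℓ₀.Prime]
    (hN : ¬ 3 ∣ W.conductorNorm ℤ) (hΦ : IsRationalLine W 3 Φ)
    (hpar : (LineEven W 3 Φ ∧ LineUnramifiedAt W 3 Φ) ∨ (LineOdd W 3 Φ ∧ ¬ LineUnramifiedAt W 3 Φ))
    (hℓ₀ : ℓ₀ ∣ W.conductorNorm ℤ) (hr : numPrimesAbove 3 ℓ₀ = 1) (hA : Addv W ℓ₀ → ℓ₀ % 3 = 2) :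
    {d : ℤ | IsOddQuadraticCharDiscr d ∧ TwistConclusion W 3 d}.Infinite :=
  (h W Φ ℓ₀ hN hΦ hpar hℓ₀ hr hA).infinite

/-- **Thm. 3.2 ⇒ infinitely many twists with the `3`-part of the rank-one BSD formula.**
[cite: BurungaleSkinner2023, Thm. 3.2 (p. 25)] -/
theorem thm32_infinitelyMany_twists_pPartBSD (h : thm32_posProportion_twists_pPartBSD)
    (W : WeierstrassCurve ℚ) [W.IsElliptic] [W.IsGloballyMinimal]
    (Φ : AddSubgroup (geomTorsion W (3 : ℤ))) (ℓ₀ : ℕ) [Fact ℓ₀.Prime]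
    (hN : ¬ 3 ∣ W.conductorNorm ℤ) (hΦ : IsRationalLine W 3 Φ)
    (hpar : (LineEven W 3 Φ ∧ LineUnramifiedAt W 3 Φ) ∨ (LineOdd W 3 Φ ∧ ¬ LineUnramifiedAt W 3 Φ))
    (hℓ₀ : ℓ₀ ∣ W.conductorNorm ℤ) (hr : numPrimesAbove 3 ℓ₀ = 1) (hA : Addv W ℓ₀ → ℓ₀ % 3 = 2) :
    {d : ℤ | IsOddQuadraticCharDiscr d ∧
      ((W.quadraticTwist (d : ℚ)).analyticRank = 1 ∧
        ∀ (W' : WeierstrassCurve ℚ) [W'.IsElliptic] [W'.IsGloballyMinimal] (C : VariableChange ℚ),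
          C • W.quadraticTwist (d : ℚ) = W' → PPartRankOnePrintShape W' 3)}.Infinite :=
  (h W Φ ℓ₀ hN hΦ hpar hℓ₀ hr hA).infinite

/-- **Thm. 3.5 ⇒ infinitely many even twists with `L(E^χ, 1) ≠ 0` and the `3`-part of the
rank-zero BSD formula.** [cite: BurungaleSkinner2023, Thm. 3.5 (p. 27)] -/
theorem thm35_infinitelyMany_evenTwists_pPartBSD_rankZero
    (h : thm35_posProportion_evenTwists_pPartBSD_rankZero)
    (W : WeierstrassCurve ℚ) [W.IsElliptic] [W.IsGloballyMinimal]
    (Φ : AddSubgroup (geomTorsion W (3 : ℤ))) (ℓ₀ : ℕ) [Fact ℓ₀.Prime]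
    (hN : ¬ 3 ∣ W.conductorNorm ℤ) (hΦ : IsRationalLine W 3 Φ)
    (hpar : (LineEven W 3 Φ ∧ LineUnramifiedAt W 3 Φ) ∨ (LineOdd W 3 Φ ∧ ¬ LineUnramifiedAt W 3 Φ))
    (hℓ₀ : ℓ₀ ∣ W.conductorNorm ℤ) (hr : numPrimesAbove 3 ℓ₀ = 1) (hA : Addv W ℓ₀ → ℓ₀ % 3 = 2) :
    {d : ℤ | IsEvenQuadraticCharDiscr d ∧
      ((W.quadraticTwist (d : ℚ)).entireLFunction 1 ≠ 0 ∧
        ∀ (W' : WeierstrassCurve ℚ) [W'.IsElliptic] [W'.IsGloballyMinimal] (C : VariableChange ℚ),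
          C • W.quadraticTwist (d : ℚ) = W' → PPartRankZeroPrintShape W' 3)}.Infinite :=
  (h W Φ ℓ₀ hN hΦ hpar hℓ₀ hr hA).infinite

end Literature.NumberTheory.EllipticCurves.BurungaleSkinner2023

end
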